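import Summits.QuantumFields.BalabanUV.Beta.GAN24.StaircaseCurrentPeriodic
import Summits.QuantumFields.BalabanUV.Beta.GAN24.ExitFaceSlotStaircaseDeep

/-!
# `BalabanUV.Beta.GAN24.StaircaseCurrentPeriodicDeep` — binder row G-an2-4 ∕ (CONV-C), W-slot (α-0), ROW (C) AT LEVELS `j ≥ 1`, the (γ) hand's memo
# `HOME/b2b-balaban-gan24-formalise-leaf-06/g54/C-LEVELS-GE1-g54.md` §29 («THE DEPTH TOWER», letter K2): **THE PERIOD-`M` STAIRCASE CURRENT HAS A BOUNDED `M`-PERIODIC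
# PRE-IMAGE — `Σ'_s E2_{j+1}(z,s)_{bβ}·⌊s_ν∕M⌋χ^{M}_β(s) = Σ'_s Σ_{b′} E2_{j+1}(z,s)_{bb′}·q^{(M)}_{νβ}(b′,s)`,
# `q^{(M)}_{νβ}(b′,s) := [b′ = ν]·M⁻²·σ̃^{M}_β(s) − [b′ = β]·M⁻¹·σ̃^{M}_ν(s)·χ^{M}_β(s)`, `σ̃^{M}_κ(s) := s_κ % M − (M−1)∕2`** (`ν ≠ β`; every `j`, every `d`, ANY `M ≥ 1`
# independent of the kernel's blocking `Lc`; row twin). gen 53's `StaircaseCurrentPeriodic` is `M = Lc`; the depth tower needs `M = Lc²` (and `Lc^m`), whose `Lc`-block contour sum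
# is `Lc^{d+1}·q^{(Lc)}` (K3 `DeepProfileContourSum`) — the level bridge
# (G-an2-4 CRUX TEAM (2), seat `b2b-balaban-gan24-formalise-leaf-06` = the (γ) hand, gen 54; journal INTENT I-leaf06-g54-7)

NOT IN PRINT; OUR BOOKKEEPING ([folklore] BY NAME, exactly gen 53's proof at period `M`: `StaircaseCurrentAntisymm.tsum_E2_mul_grad_eq_zero_of_quadGrowth` (E2 kills `d(s_ν·⌊s_β∕M⌋)`),
`ValueHessianFirstMoment.tsum_E2_mul_coord_eq_zero` (E2 kills `s ↦ s_β·ĉ_ν`) ∕ `E2_swap` ∕ `tsum_E2_mul_const_eq_zero'`, `ExitFaceSlotStaircase.coord_grad ∕ abs_coord_le`,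
`ExitFaceSlotStaircaseDeep.stairN_grad ∕ abs_stairN_le ∕ summable_E2_mul_linGrowth_faceN`, D1 `tsum_E2_mul_exitFace_eq_zero′` (period-free); 0 `def`, 0 cited fact, 0 `def … : Prop`, 0 sorry).
HONEST FRAMING (cell contract, verbatim): «discharging `BetaPertH` makes Bałaban's UV stability UNCONDITIONAL — a real constructive-QFT result; it is NOT the continuum
limit and NOT the Clay problem.»  HONEST DEPENDENCY (verbatim): «continuum YM on T⁴ ⇐ BetaPertH ∧ nine spine estimates (0/9 proved); BetaPertH ⇐ (D1) ∧ (D4) ∧ CAP+tail;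
G-an2-4 gates asym, D1 and NE2/3/4.»
* §1 `coord_eqM`, `stair_eqM`, `coordStair_gradM`, `abs_coordStair_leM`, `abs_csawtoothN_le`, `abs_sawFaceN_le`; §2 **`tsum_E2_mul_coordFaceM`**, **`tsum_E2_mul_stairM`**;
  §3 **`stairFace_eq_periodicM`**, **`stairFace_eq_periodic_fstM`**; §4 `qProfile_translateM`, `abs_qProfile_leM`.
Asserts NO value of Bałaban's tables; discharges NOTHING of (C) ∕ (C)sym ∕ (Q-L) ∕ «T2Shape» ∕ «T2Drift» ∕ (hW, hWall); NEVER «G-an2-4 closed» as (CONV-C); NOT D1, NOT `BetaPertH`,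
NOT continuum, NOT Clay.  2026-08-24; no existing file touched.
-/

noncomputable section

open Finset
open scoped BigOperators
open Literature.MathematicalPhysics.QuantumFieldTheory
open Literature.MathematicalPhysics.QuantumFieldTheory.Balaban1983to89
open Literature.MathematicalPhysics.QuantumFieldTheory.Balaban1983to89.Beta
open B12Sec2to5 (l1 l1_nonneg)
open ExpKernelCalculus (Site)
open AffineAveraging (box toSite unitVec)
open BalabanStepJetsSucc (E2)
open Summit.QuantumFields.BalabanUV.Beta.AxialDressingRooted (one_le_of_neZero)
open Summit.QuantumFields.BalabanUV.Beta.GAN24.ValueHessianLinearGauge (tsum_E2_mul_exitFace_eq_zero')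
open Summit.QuantumFields.BalabanUV.Beta.GAN24.ExitFaceHalfVertexSplit (abs_sawtooth_le)
open Summit.QuantumFields.BalabanUV.Beta.GAN24.ExchangeE2E2ChannelValue (sum_mul_ite_leg)
open Summit.QuantumFields.BalabanUV.Beta.GAN24.ExitFaceSlotStaircase (coord_grad abs_coord_le)
open Summit.QuantumFields.BalabanUV.Beta.GAN24.StaircaseCurrentAntisymm (tsum_E2_mul_grad_eq_zero_of_quadGrowth)
open Summit.QuantumFields.BalabanUV.Beta.GAN24.ValueHessianFirstMoment (summable_E2_mul_linGrowth tsum_E2_mul_coord_eq_zero tsum_E2_mul_const_eq_zero' E2_swap)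
open Summit.QuantumFields.BalabanUV.Beta.GAN24.ExitFaceSlotStaircaseDeep (stairN_grad abs_stairN_le summable_E2_mul_linGrowth_faceN)

namespace Summit.QuantumFields.BalabanUV.Beta.GAN24.StaircaseCurrentPeriodicDeep

variable {d : ℕ} {Lc : ℕ} [NeZero Lc]

omit [NeZero Lc] in
/-- [folklore] The period-`M` centred sawtooth is bounded: `|s_ν % M − c| ≤ (M + |c|) + 0·|s|₁` (`1 ≤ M`). -/
theorem abs_csawtoothN_le {M : ℕ} (hM : 1 ≤ M) (c : ℝ) (ν : Fin (d + 1)) (t : Fin (d + 1) → ℤ) :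
    |((t ν % (M : ℤ) : ℤ) : ℝ) - c| ≤ ((M : ℝ) + |c|) + 0 * l1 t := by
  have hM0 : (0 : ℤ) < M := by exact_mod_cast hM
  have h0 : 0 ≤ t ν % (M : ℤ) := Int.emod_nonneg _ hM0.ne'
  have h1 : t ν % (M : ℤ) < (M : ℤ) := Int.emod_lt_of_pos _ hM0
  have h0' : (0 : ℝ) ≤ ((t ν % (M : ℤ) : ℤ) : ℝ) := by exact_mod_cast h0
  have h1' : ((t ν % (M : ℤ) : ℤ) : ℝ) < (M : ℝ) := by exact_mod_cast h1
  rw [zero_mul, add_zero]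
  calc |((t ν % (M : ℤ) : ℤ) : ℝ) - c| ≤ |((t ν % (M : ℤ) : ℤ) : ℝ)| + |c| := abs_sub _ _
    _ ≤ (M : ℝ) + |c| := by rw [abs_of_nonneg h0']; linarith

omit [NeZero Lc] in
/-- [folklore] The period-`M` «sawtooth × exit face» profile is bounded by `|c|·(M + |e|)` (`1 ≤ M`). -/
theorem abs_sawFaceN_le {M : ℕ} (hM : 1 ≤ M) (c e : ℝ) (μ α b : Fin (d + 1)) (y : Site (d + 1)) :
    |(if b = α then (c * (((y μ % (M : ℤ) : ℤ) : ℝ) - e)) * (if y α % (M : ℤ) = (M : ℤ) - 1 then (1 : ℝ) else 0) else 0)| ≤ |c| * ((M : ℝ) + |e|) := by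
  have hs := abs_csawtoothN_le (d := d) hM e μ y
  rw [zero_mul, add_zero] at hs
  have h0 : 0 ≤ |c| * ((M : ℝ) + |e|) := by positivity
  split_ifs
  · rw [mul_one, abs_mul]
    exact mul_le_mul_of_nonneg_left hs (abs_nonneg c)
  · rwa [mul_zero, abs_zero]
  · rwa [abs_zero]

/-! ## §1 Staircase and sawtooth bookkeeping -/

omit [NeZero Lc] in
/-- [folklore] `s_ν = Lc·⌊s_ν∕Lc⌋ + s_ν % Lc` (as reals). -/
theorem coord_eqM {M : ℕ} (ν : Fin (d + 1)) (s : Site (d + 1)) :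
    ((s ν : ℤ) : ℝ) = (M : ℝ) * (((s ν / (M : ℤ) : ℤ) : ℝ)) + ((s ν % (M : ℤ) : ℤ) : ℝ) := by
  have h : (M : ℤ) * (s ν / (M : ℤ)) + s ν % (M : ℤ) = s ν := Int.mul_ediv_add_emod _ _
  have h' := congrArg (Int.cast : ℤ → ℝ) h
  push_cast at h'
  linarith

omit [NeZero Lc] in
/-- [folklore] Hence `⌊s_ν∕Lc⌋ = Lc⁻¹·(s_ν − σ̃_ν(s) − (Lc−1)∕2)` with the centred sawtooth `σ̃_ν(s) = s_ν % Lc − (Lc−1)∕2`. -/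
theorem stair_eqM {M : ℕ} (hM : 1 ≤ M) (ν : Fin (d + 1)) (s : Site (d + 1)) :
    (((s ν / (M : ℤ) : ℤ) : ℝ)) = (M : ℝ)⁻¹ * (((s ν : ℤ) : ℝ) - ((((s ν % (M : ℤ) : ℤ) : ℝ) - ((M : ℝ) - 1) / 2)) - ((M : ℝ) - 1) / 2) := by
  have hL0 : (M : ℝ) ≠ 0 := by exact_mod_cast (Nat.one_le_iff_ne_zero.1 hM)
  have h := coord_eqM (M := M) ν s
  field_simp
  linarith

omit [NeZero Lc] in
/-- [folklore] The gradient of `s ↦ s_ν·⌊s_β∕Lc⌋` (`ν ≠ β`, `1 ≤ Lc`): `[l = ν]·⌊s_β∕Lc⌋ + [l = β]·s_ν·χ_β(s)`. -/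
theorem coordStair_gradM {M : ℕ} (hM : 1 ≤ M) {ν β : Fin (d + 1)} (hνβ : ν ≠ β) (s : Site (d + 1)) (l : Fin (d + 1)) :
    (((s + unitVec l) ν : ℤ) : ℝ) * ((((s + unitVec l) β / (M : ℤ) : ℤ) : ℝ)) - ((s ν : ℤ) : ℝ) * (((s β / (M : ℤ) : ℤ) : ℝ)) =
      (if l = ν then (((s β / (M : ℤ) : ℤ) : ℝ)) else 0)
        + (if l = β then ((s ν : ℤ) : ℝ) * (if s β % (M : ℤ) = (M : ℤ) - 1 then 1 else 0) else 0) := by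
  have hν := coord_grad ν l s
  have hβ := stairN_grad (d := d) hM β l s
  have eν : (((s + unitVec l) ν : ℤ) : ℝ) = ((s ν : ℤ) : ℝ) + (if l = ν then 1 else 0) := by linarith
  have eβ : ((((s + unitVec l) β / (M : ℤ) : ℤ) : ℝ)) = (((s β / (M : ℤ) : ℤ) : ℝ)) + (if l = β then (if s β % (M : ℤ) = (M : ℤ) - 1 then 1 else 0) else 0) := by
    linarith
  rw [eν, eβ]
  by_cases hlν : l = ν
  · subst hlν
    simp only [if_true, if_neg hνβ]
    ring
  · simp only [if_neg hlν]
    split_ifs <;> ring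

omit [NeZero Lc] in
/-- [folklore] Quadratic growth of `s ↦ s_ν·⌊s_β∕Lc⌋`. -/
theorem abs_coordStair_leM {M : ℕ} (ν β : Fin (d + 1)) (s : Site (d + 1)) :
    |((s ν : ℤ) : ℝ) * (((s β / (M : ℤ) : ℤ) : ℝ))| ≤ 0 + 1 * l1 s ^ 2 := by
  have h1 := abs_coord_le ν s
  have h2 := abs_stairN_le (d := d) M β s
  rw [zero_add, one_mul] at h1 h2 ⊢
  rw [abs_mul, sq]
  exact mul_le_mul h1 h2 (abs_nonneg _) (l1_nonneg s)

/-! ## §2 Two trades under the value Hessian -/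

/-- [folklore] **`Σ'_s E2(z,s)_{bβ}·s_ν·χ_β(s) = −Σ'_s E2(z,s)_{bν}·⌊s_β∕Lc⌋`** (`ν ≠ β`): E2 kills `d(s_ν·⌊s_β∕Lc⌋)`. -/
theorem tsum_E2_mul_coordFaceM {M : ℕ} (hM : 1 ≤ M) (j : ℕ) {ν β : Fin (d + 1)} (hνβ : ν ≠ β) (z : Site (d + 1)) (b : Fin (d + 1)) :
    ∑' s : Site (d + 1), E2 d Lc (j + 1) z s (Sum.inl b) (Sum.inl β) * (((s ν : ℤ) : ℝ) * (if s β % (M : ℤ) = (M : ℤ) - 1 then (1 : ℝ) else 0)) =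
      -∑' s : Site (d + 1), E2 d Lc (j + 1) z s (Sum.inl b) (Sum.inl ν) * (((s β / (M : ℤ) : ℤ) : ℝ)) := by
  have key := tsum_E2_mul_grad_eq_zero_of_quadGrowth (Lc := Lc) (j + 1) b z
    (φ := fun s : Site (d + 1) => ((s ν : ℤ) : ℝ) * (((s β / (M : ℤ) : ℤ) : ℝ))) (abs_coordStair_leM (M := M) ν β)
  have hpt : ∀ s : Site (d + 1), (∑ l, E2 d Lc (j + 1) z s (Sum.inl b) (Sum.inl l) *
      ((((s + unitVec l) ν : ℤ) : ℝ) * ((((s + unitVec l) β / (M : ℤ) : ℤ) : ℝ)) - ((s ν : ℤ) : ℝ) * (((s β / (M : ℤ) : ℤ) : ℝ)))) =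
      E2 d Lc (j + 1) z s (Sum.inl b) (Sum.inl ν) * (((s β / (M : ℤ) : ℤ) : ℝ))
        + E2 d Lc (j + 1) z s (Sum.inl b) (Sum.inl β) * (((s ν : ℤ) : ℝ) * (if s β % (M : ℤ) = (M : ℤ) - 1 then (1 : ℝ) else 0)) := by
    intro s
    simp_rw [coordStair_gradM hM hνβ s, mul_add, Finset.sum_add_distrib]
    rw [Finset.sum_eq_single ν (fun l _ hl => by rw [if_neg hl, mul_zero]) (fun h => absurd (Finset.mem_univ ν) h),
      Finset.sum_eq_single β (fun l _ hl => by rw [if_neg hl, mul_zero]) (fun h => absurd (Finset.mem_univ β) h), if_pos rfl, if_pos rfl]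
  rw [tsum_congr hpt] at key
  have h1 : Summable fun s : Site (d + 1) => E2 d Lc (j + 1) z s (Sum.inl b) (Sum.inl ν) * (((s β / (M : ℤ) : ℤ) : ℝ)) :=
    summable_E2_mul_linGrowth (Lc := Lc) (j + 1) z b ν (abs_stairN_le M β)
  have h2 := summable_E2_mul_linGrowth_faceN (d := d) (Lc := Lc) j (lam := fun s : Site (d + 1) => ((s ν : ℤ) : ℝ)) (abs_coord_le ν) M z b β
  rw [h1.tsum_add h2] at key
  linarith

/-- [folklore] **`Σ'_s E2(z,s)_{bν}·⌊s_β∕Lc⌋ = −Lc⁻¹·Σ'_s E2(z,s)_{bν}·σ̃_β(s)`**: `Lc·⌊s_β∕Lc⌋ = s_β − σ̃_β(s) − (Lc−1)∕2`, E2 kills the linear form (`ValueHessianFirstMoment`) and the constant. -/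
theorem tsum_E2_mul_stairM {M : ℕ} (hM : 1 ≤ M) (j : ℕ) (ν β : Fin (d + 1)) (z : Site (d + 1)) (b : Fin (d + 1)) :
    ∑' s : Site (d + 1), E2 d Lc (j + 1) z s (Sum.inl b) (Sum.inl ν) * (((s β / (M : ℤ) : ℤ) : ℝ)) =
      -(M : ℝ)⁻¹ * ∑' s : Site (d + 1), E2 d Lc (j + 1) z s (Sum.inl b) (Sum.inl ν) * ((((s β % (M : ℤ) : ℤ) : ℝ) - ((M : ℝ) - 1) / 2)) := by
  have hpt : ∀ s : Site (d + 1), E2 d Lc (j + 1) z s (Sum.inl b) (Sum.inl ν) * (((s β / (M : ℤ) : ℤ) : ℝ)) =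
      (M : ℝ)⁻¹ * (E2 d Lc (j + 1) z s (Sum.inl b) (Sum.inl ν) * ((s β : ℤ) : ℝ))
        - (M : ℝ)⁻¹ * (E2 d Lc (j + 1) z s (Sum.inl b) (Sum.inl ν) * ((((s β % (M : ℤ) : ℤ) : ℝ) - ((M : ℝ) - 1) / 2)))
        - (M : ℝ)⁻¹ * (E2 d Lc (j + 1) z s (Sum.inl b) (Sum.inl ν) * (((M : ℝ) - 1) / 2)) := by
    intro s
    rw [stair_eqM hM β s]
    ring
  have h1 : Summable fun s : Site (d + 1) => E2 d Lc (j + 1) z s (Sum.inl b) (Sum.inl ν) * ((s β : ℤ) : ℝ) :=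
    summable_E2_mul_linGrowth (Lc := Lc) (j + 1) z b ν (abs_coord_le β)
  have h2 : Summable fun s : Site (d + 1) => E2 d Lc (j + 1) z s (Sum.inl b) (Sum.inl ν) * ((((s β % (M : ℤ) : ℤ) : ℝ) - ((M : ℝ) - 1) / 2)) :=
    summable_E2_mul_linGrowth (Lc := Lc) (j + 1) z b ν (abs_csawtoothN_le (d := d) hM (((M : ℝ) - 1) / 2) β)
  have h3 : Summable fun s : Site (d + 1) => E2 d Lc (j + 1) z s (Sum.inl b) (Sum.inl ν) * (((M : ℝ) - 1) / 2) :=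
    summable_E2_mul_linGrowth (Lc := Lc) (j + 1) z b ν (φ := fun _ => ((M : ℝ) - 1) / 2) (A := |((M : ℝ) - 1) / 2|) (B := 0)
      fun _ => by rw [zero_mul, add_zero]
  rw [tsum_congr hpt, ((h1.mul_left _).sub (h2.mul_left _)).tsum_sub (h3.mul_left _), (h1.mul_left _).tsum_sub (h2.mul_left _),
    tsum_mul_left, tsum_mul_left, tsum_mul_left, tsum_E2_mul_coord_eq_zero (Lc := Lc) (j + 1) b ν β z,
    tsum_E2_mul_const_eq_zero' (Lc := Lc) (j + 1) z b ν]
  ring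

/-! ## §3 The periodic pre-image of the staircase current -/

/-- [folklore] **THE STAIRCASE CURRENT AS THE VALUE-HESSIAN IMAGE OF A BOUNDED PERIODIC CONTOUR-FREE PROFILE** (`ν ≠ β`; second leg, open leg `(b, z)`):
`Σ'_s E2_{j+1}(z,s)_{bβ}·⌊s_ν∕Lc⌋χ_β(s) = Σ'_s Σ_{b′} E2_{j+1}(z,s)_{bb′}·q_{νβ}(b′,s)`,
`q_{νβ}(b′,s) = [b′ = ν]·Lc⁻²·σ̃_β(s) + [b′ = β]·(−Lc⁻¹·σ̃_ν(s))·χ_β(s)`. -/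
theorem stairFace_eq_periodicM {M : ℕ} (hM : 1 ≤ M) (j : ℕ) {ν β : Fin (d + 1)} (hνβ : ν ≠ β) (z : Site (d + 1)) (b : Fin (d + 1)) :
    ∑' s : Site (d + 1), E2 d Lc (j + 1) z s (Sum.inl b) (Sum.inl β) * ((((s ν / (M : ℤ) : ℤ) : ℝ)) * (if s β % (M : ℤ) = (M : ℤ) - 1 then (1 : ℝ) else 0)) =
      ∑' s : Site (d + 1), ∑ b' : Fin (d + 1), E2 d Lc (j + 1) z s (Sum.inl b) (Sum.inl b') *
        ((if b' = ν then ((M : ℝ)⁻¹ * (M : ℝ)⁻¹) * ((((s β % (M : ℤ) : ℤ) : ℝ) - ((M : ℝ) - 1) / 2)) else 0)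
          + (if b' = β then (-(M : ℝ)⁻¹ * ((((s ν % (M : ℤ) : ℤ) : ℝ) - ((M : ℝ) - 1) / 2))) * (if s β % (M : ℤ) = (M : ℤ) - 1 then (1 : ℝ) else 0) else 0)) := by
  -- left: staircase = Lc⁻¹(coordinate − centred sawtooth − offset), pointwise
  have hpt : ∀ s : Site (d + 1), E2 d Lc (j + 1) z s (Sum.inl b) (Sum.inl β) * ((((s ν / (M : ℤ) : ℤ) : ℝ)) * (if s β % (M : ℤ) = (M : ℤ) - 1 then (1 : ℝ) else 0)) =
      (M : ℝ)⁻¹ * (E2 d Lc (j + 1) z s (Sum.inl b) (Sum.inl β) * (((s ν : ℤ) : ℝ) * (if s β % (M : ℤ) = (M : ℤ) - 1 then (1 : ℝ) else 0)))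
        - (M : ℝ)⁻¹ * (E2 d Lc (j + 1) z s (Sum.inl b) (Sum.inl β) * (((((s ν % (M : ℤ) : ℤ) : ℝ) - ((M : ℝ) - 1) / 2)) * (if s β % (M : ℤ) = (M : ℤ) - 1 then (1 : ℝ) else 0)))
        - (M : ℝ)⁻¹ * (E2 d Lc (j + 1) z s (Sum.inl b) (Sum.inl β) * (if s β % (M : ℤ) = (M : ℤ) - 1 then (((M : ℝ) - 1) / 2) else 0)) := by
    intro s
    rw [stair_eqM hM ν s]
    split_ifs <;> ring
  have h1 := summable_E2_mul_linGrowth_faceN (d := d) (Lc := Lc) j (lam := fun s : Site (d + 1) => ((s ν : ℤ) : ℝ)) (abs_coord_le ν) M z b β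
  have h2 := summable_E2_mul_linGrowth_faceN (d := d) (Lc := Lc) j (lam := fun s : Site (d + 1) => (((s ν % (M : ℤ) : ℤ) : ℝ) - ((M : ℝ) - 1) / 2))
    (abs_csawtoothN_le (d := d) hM (((M : ℝ) - 1) / 2) ν) M z b β
  have h3 : Summable fun s : Site (d + 1) => E2 d Lc (j + 1) z s (Sum.inl b) (Sum.inl β) * (if s β % (M : ℤ) = (M : ℤ) - 1 then (((M : ℝ) - 1) / 2) else 0) := by
    have h := summable_E2_mul_linGrowth_faceN (d := d) (Lc := Lc) j (lam := fun _ : Site (d + 1) => ((M : ℝ) - 1) / 2) (A := |((M : ℝ) - 1) / 2|) (B := 0)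
      (fun _ => by rw [zero_mul, add_zero]) M z b β
    refine h.congr fun s => ?_
    split_ifs <;> simp
  rw [tsum_congr hpt, ((h1.mul_left _).sub (h2.mul_left _)).tsum_sub (h3.mul_left _), (h1.mul_left _).tsum_sub (h2.mul_left _),
    tsum_mul_left, tsum_mul_left, tsum_mul_left, tsum_E2_mul_coordFaceM hM j hνβ z b, tsum_E2_mul_stairM hM j ν β z b,
    tsum_E2_mul_exitFace_eq_zero' (Lc := Lc) (j + 1) hM b β z (((M : ℝ) - 1) / 2), mul_zero, sub_zero]
  -- right: collapse the leg sum into the two profiles and split the series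
  have hR : ∀ s : Site (d + 1), (∑ b' : Fin (d + 1), E2 d Lc (j + 1) z s (Sum.inl b) (Sum.inl b') *
      ((if b' = ν then ((M : ℝ)⁻¹ * (M : ℝ)⁻¹) * ((((s β % (M : ℤ) : ℤ) : ℝ) - ((M : ℝ) - 1) / 2)) else 0)
        + (if b' = β then (-(M : ℝ)⁻¹ * ((((s ν % (M : ℤ) : ℤ) : ℝ) - ((M : ℝ) - 1) / 2))) * (if s β % (M : ℤ) = (M : ℤ) - 1 then (1 : ℝ) else 0) else 0))) =
      ((M : ℝ)⁻¹ * (M : ℝ)⁻¹) * (E2 d Lc (j + 1) z s (Sum.inl b) (Sum.inl ν) * ((((s β % (M : ℤ) : ℤ) : ℝ) - ((M : ℝ) - 1) / 2)))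
        - (M : ℝ)⁻¹ * (E2 d Lc (j + 1) z s (Sum.inl b) (Sum.inl β) * (((((s ν % (M : ℤ) : ℤ) : ℝ) - ((M : ℝ) - 1) / 2)) * (if s β % (M : ℤ) = (M : ℤ) - 1 then (1 : ℝ) else 0))) := by
    intro s
    simp_rw [mul_add, Finset.sum_add_distrib, sum_mul_ite_leg]
    ring
  have h4 : Summable fun s : Site (d + 1) => E2 d Lc (j + 1) z s (Sum.inl b) (Sum.inl ν) * ((((s β % (M : ℤ) : ℤ) : ℝ) - ((M : ℝ) - 1) / 2)) :=
    summable_E2_mul_linGrowth (Lc := Lc) (j + 1) z b ν (abs_csawtoothN_le (d := d) hM (((M : ℝ) - 1) / 2) β)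
  rw [tsum_congr hR, (h4.mul_left _).tsum_sub (h2.mul_left _), tsum_mul_left, tsum_mul_left]
  ring

/-- [folklore] **… FIRST-LEG TWIN** (`μ ≠ α`; open leg `(a, x)`): `Σ'_y (⌊y_μ∕Lc⌋·χ_α(y))·E2_{j+1}(y,x)_{αa} = Σ'_y Σ_b E2_{j+1}(y,x)_{ba}·q_{μα}(b,y)` (reciprocity `E2_swap`). -/
theorem stairFace_eq_periodic_fstM {M : ℕ} (hM : 1 ≤ M) (j : ℕ) {μ α : Fin (d + 1)} (hμα : μ ≠ α) (x : Site (d + 1)) (a : Fin (d + 1)) :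
    ∑' y : Site (d + 1), ((((y μ / (M : ℤ) : ℤ) : ℝ)) * (if y α % (M : ℤ) = (M : ℤ) - 1 then (1 : ℝ) else 0)) * E2 d Lc (j + 1) y x (Sum.inl α) (Sum.inl a) =
      ∑' y : Site (d + 1), ∑ b : Fin (d + 1), E2 d Lc (j + 1) y x (Sum.inl b) (Sum.inl a) *
        ((if b = μ then ((M : ℝ)⁻¹ * (M : ℝ)⁻¹) * ((((y α % (M : ℤ) : ℤ) : ℝ) - ((M : ℝ) - 1) / 2)) else 0)
          + (if b = α then (-(M : ℝ)⁻¹ * ((((y μ % (M : ℤ) : ℤ) : ℝ) - ((M : ℝ) - 1) / 2))) * (if y α % (M : ℤ) = (M : ℤ) - 1 then (1 : ℝ) else 0) else 0)) := by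
  have h := stairFace_eq_periodicM (Lc := Lc) hM j hμα x a
  have hl : ∑' y : Site (d + 1), ((((y μ / (M : ℤ) : ℤ) : ℝ)) * (if y α % (M : ℤ) = (M : ℤ) - 1 then (1 : ℝ) else 0)) * E2 d Lc (j + 1) y x (Sum.inl α) (Sum.inl a) =
      ∑' y : Site (d + 1), E2 d Lc (j + 1) x y (Sum.inl a) (Sum.inl α) * ((((y μ / (M : ℤ) : ℤ) : ℝ)) * (if y α % (M : ℤ) = (M : ℤ) - 1 then (1 : ℝ) else 0)) :=
    tsum_congr fun y => by rw [E2_swap (Lc := Lc) (j + 1) x y α a, mul_comm]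
  rw [hl, h]
  refine tsum_congr fun y => Finset.sum_congr rfl fun b _ => ?_
  rw [E2_swap (Lc := Lc) (j + 1) x y b a]

/-! ## §4 The pre-image is admissible: periodic, bounded, contour-free -/

omit [NeZero Lc] in
/-- [folklore] The profile `q_{νβ}` is `Lc`-periodic. -/
theorem qProfile_translateM {M : ℕ} (ν β b' : Fin (d + 1)) (s t : Site (d + 1)) :
    ((if b' = ν then ((M : ℝ)⁻¹ * (M : ℝ)⁻¹) * (((((s + (M : ℤ) • t) β % (M : ℤ) : ℤ) : ℝ) - ((M : ℝ) - 1) / 2)) else 0)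
        + (if b' = β then (-(M : ℝ)⁻¹ * (((((s + (M : ℤ) • t) ν % (M : ℤ) : ℤ) : ℝ) - ((M : ℝ) - 1) / 2))) *
            (if (s + (M : ℤ) • t) β % (M : ℤ) = (M : ℤ) - 1 then (1 : ℝ) else 0) else 0)) =
      ((if b' = ν then ((M : ℝ)⁻¹ * (M : ℝ)⁻¹) * ((((s β % (M : ℤ) : ℤ) : ℝ) - ((M : ℝ) - 1) / 2)) else 0)
        + (if b' = β then (-(M : ℝ)⁻¹ * ((((s ν % (M : ℤ) : ℤ) : ℝ) - ((M : ℝ) - 1) / 2))) * (if s β % (M : ℤ) = (M : ℤ) - 1 then (1 : ℝ) else 0) else 0)) := by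
  simp only [Pi.add_apply, Pi.smul_apply, smul_eq_mul, Int.add_mul_emod_self_left]

omit [NeZero Lc] in
/-- [folklore] The profile `q_{νβ}` is bounded (`1 ≤ Lc`). -/
theorem abs_qProfile_leM {M : ℕ} (hM : 1 ≤ M) (ν β b' : Fin (d + 1)) (s : Site (d + 1)) :
    |((if b' = ν then ((M : ℝ)⁻¹ * (M : ℝ)⁻¹) * ((((s β % (M : ℤ) : ℤ) : ℝ) - ((M : ℝ) - 1) / 2)) else 0)
        + (if b' = β then (-(M : ℝ)⁻¹ * ((((s ν % (M : ℤ) : ℤ) : ℝ) - ((M : ℝ) - 1) / 2))) * (if s β % (M : ℤ) = (M : ℤ) - 1 then (1 : ℝ) else 0) else 0))| ≤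
      |(M : ℝ)⁻¹ * (M : ℝ)⁻¹| * ((M : ℝ) + |((M : ℝ) - 1) / 2|) + |-(M : ℝ)⁻¹| * ((M : ℝ) + |((M : ℝ) - 1) / 2|) := by
  refine (abs_add_le _ _).trans (add_le_add ?_ (abs_sawFaceN_le hM _ _ ν β b' s))
  have hs := abs_csawtoothN_le (d := d) hM (((M : ℝ) - 1) / 2) β s
  rw [zero_mul, add_zero] at hs
  have h0 : 0 ≤ |(M : ℝ)⁻¹ * (M : ℝ)⁻¹| * ((M : ℝ) + |((M : ℝ) - 1) / 2|) := by positivity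
  split_ifs
  · rw [abs_mul]
    exact mul_le_mul_of_nonneg_left hs (abs_nonneg _)
  · rwa [abs_zero]

end Summit.QuantumFields.BalabanUV.Beta.GAN24.StaircaseCurrentPeriodicDeep

end
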